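import Literature.NumberTheory.EllipticCurves.CPMuDescentK3BoxSplitTwoNodeKill
import Literature.NumberTheory.NumberFields.EisensteinFieldSelmerNormCubeSplitThree
import HarnessLib

/-!
# The `α̂`-box over `ℚ(√−3)` with THREE split primes, CUT by the local condition at a killing place: one relation and THREE
# generators (Cohen–Pazuki 2009, Thm. 2.1 with the local condition at a prime `q ∣ s` of the isogenous curve, Prop. 2.2)

Topic `NumberTheory/EllipticCurves`. Sequel of `CPMuDescentK3BoxSplitTwoNodeKill`. Crude `K3`-box `⟨[ζ], [ϖ₁ϖ̄₁²], [ϖ₂ϖ̄₂²], [ϖ₃ϖ̄₃²]⟩`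
(`EisensteinFieldSelmerNormCubeSplitThree`); at a node place `w₀` (`w₀ ∣ s`, `w₀ ∤ 6Np₁p₂p₃`, `9 ∤ N(w₀) − 1`) the residue certificates
`ϖᵢϖ̄ᵢ² ≡ ζ^{cᵢ} yᵢ³ (mod w₀)` give ONE relation `3 ∣ i + c₁k₁ + c₂k₂ + c₃k₃`; the surviving `3`-space is spanned by `[ζ^{eᵢ} ϖᵢϖ̄ᵢ²]`,
`eᵢ ≡ −cᵢ (mod 3)`, so THREE descent classes of points of `Ê₃(K3)` book the `K3` side:
* **`torsorClass_eq_zero_of_mem_sha_of_norm_cube_of_gens_split₃NodeKill`**, **`shaCorank_three_eq_zero_of_gens_split₃NodeKill`** —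
  the shape of the rank-3 curves 287014d1 and 413231b1 (`S = {83}` resp. `{239}`, `N = 2` resp. `1`, split `7, 13, 19`).
Theorems only; no definitions, no named facts.

## References
* [CohenPazuki2009] H. Cohen, F. Pazuki, *Elementary 3-descent with a 3-isogeny*, Acta Arith. 140 (2009), Def. 1.3, Thm. 2.1, Prop. 2.2.
* [SilvermanAEC2009] J. H. Silverman, *The Arithmetic of Elliptic Curves*, 2nd ed. (2009), Thm. X.4.2 (a), Prop. X.4.9.
* [IrelandRosen1990] K. Ireland, M. Rosen, GTM 84, Ch. 9 §3 (cubic residue character).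
-/

noncomputable section

open scoped Classical
open WeierstrassCurve IsDedekindDomain IsDedekindDomain.HeightOneSpectrum NumberField

namespace Literature.NumberTheory.EllipticCurves

namespace CPMuDescent

open MordellDescent ThreeTorsionDescent MuThreeKernel WithZero
open Literature.NumberTheory.NumberFields Literature.NumberTheory.NumberFields.K3

/-! ## Bookkeeping on cube classes -/

/-- `[ζ^i x] = [ζ^j x]` when `i ≡ j (mod 3)` (bookkeeping, private copy). [cite: CohenPazuki2009, Def. 1.3] -/
private theorem cubeClass_zeta_pow_mul_eq₃ {i j : ℕ} (hij : i % 3 = j % 3) (x : K3) :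
    cubeClass ((zeta : K3) ^ i * x) = cubeClass ((zeta : K3) ^ j * x) := by
  have key : ∀ n : ℕ, cubeClass ((zeta : K3) ^ n * x) = cubeClass ((zeta : K3) ^ (n % 3) * x) := by
    intro n
    conv_lhs => rw [← Nat.div_add_mod n 3, pow_add, pow_mul, isPrimitiveRoot_zeta.pow_eq_one, one_pow, one_mul]
  rw [key i, key j, hij]

/-- `[x^n] = [x]^n` for `x ≠ 0` (bookkeeping, private copy). [cite: CohenPazuki2009, Def. 1.3] -/
private theorem cubeClass_pow_K3₃ {x : K3} (hx : x ≠ 0) (n : ℕ) : cubeClass (x ^ n) = cubeClass x ^ n := by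
  induction n with
  | zero => rw [pow_zero, pow_zero, cubeClass_one]
  | succ k ih => rw [pow_succ, pow_succ, cubeClass_mul (pow_ne_zero _ hx) hx, ih]

/-- `ϖ ≠ 0` in `K3` when `a² − ab + b² = p` is prime (bookkeeping, private). [cite: IrelandRosen1990, Prop. 9.1.4] -/
private theorem varpi_ne_zero₃' {p : ℕ} (hp : p.Prime) {a b : ℤ} (hab : a ^ 2 - a * b + b ^ 2 = p) : (⟨a, b⟩ : K3) ≠ 0 := by
  intro h0
  have hp0 : (p : ℤ) ≠ 0 := by exact_mod_cast hp.ne_zero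
  have ha : (a : ℚ) = 0 := congrArg QuadraticAlgebra.re h0
  have hb : (b : ℚ) = 0 := congrArg QuadraticAlgebra.im h0
  have ha' : a = 0 := by exact_mod_cast ha
  have hb' : b = 0 := by exact_mod_cast hb
  subst ha'; subst hb'
  exact hp0 (by rw [← hab]; ring)

/-- `ϖ̄ ≠ 0` in `K3` when `a² − ab + b² = p` is prime (bookkeeping, private). [cite: IrelandRosen1990, Prop. 9.1.4] -/
private theorem varpi_conj_ne_zero₃' {p : ℕ} (hp : p.Prime) {a b : ℤ} (hab : a ^ 2 - a * b + b ^ 2 = p) :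
    (⟨a - b, -b⟩ : K3) ≠ 0 := by
  have h := varpi_ne_zero₃' hp ((norm_conj_eq a b).trans hab)
  intro h0; apply h
  have e : (⟨((a - b : ℤ) : ℚ), ((-b : ℤ) : ℚ)⟩ : K3) = ⟨(a : ℚ) - b, -b⟩ := by push_cast; rfl
  rw [e]; exact h0

/-! ## The `K3`-box with three split primes, cut at a killing place: three generators -/

/-- **The `α̂`-box over `K3` with three split primes and a killing place: THREE generators.** For a Cohen–Pazuki pair
`cpCurve a₃ b₃ → threeTorsionModel m₃ s₃` over `K3`, `N ≠ 0` with inert prime factors, pairwise distinct split primes `pᵢ = ϖᵢϖ̄ᵢ`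
(`i ≤ 3`, `pᵢ ≡ 1 (3)`), `w(2s₃) = 1`, `w(2m₃) ≤ 1` off `3Np₁p₂p₃`; a killing place `w₀ ∌ 3Np₁p₂p₃` with `w₀(2) = 1`, `w₀(s₃) = 1`,
`w₀(27s₃ − 4m₃³) < 1`, `9 ∤ N(w₀) − 1`, residue certificates `ϖᵢϖ̄ᵢ² ≡ ζ^{cᵢ} yᵢ³ (mod w₀)`; and THREE generators `[ζ^{eᵢ} ϖᵢϖ̄ᵢ²] ∈ G`
with `3 ∣ eᵢ + cᵢ`, `G = ⟨[α̂(P)] : P ∈ Ê₃(K3)⟩`: every `μ₃`-torsor class `[C_u]`, `u` of cube norm, lying in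
`Ш(V₃/K3)` vanishes. [cite: CohenPazuki2009, Theorem 2.1 and Proposition 2.2] [cite: SilvermanAEC2009, Prop. X.4.9] -/
theorem torsorClass_eq_zero_of_mem_sha_of_norm_cube_of_gens_split₃NodeKill {N : ℕ} (hN0 : N ≠ 0)
    (hN : ∀ q ∈ N.primeFactors, q = 2 ∨ q % 3 = 2) {p₁ : ℕ} (hp₁ : p₁.Prime) (hp₁1 : p₁ % 3 = 1) {a₁ b₁ : ℤ}
    (hab₁ : a₁ ^ 2 - a₁ * b₁ + b₁ ^ 2 = p₁) {p₂ : ℕ} (hp₂ : p₂.Prime) (hp₂1 : p₂ % 3 = 1) {a₂ b₂ : ℤ}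
    (hab₂ : a₂ ^ 2 - a₂ * b₂ + b₂ ^ 2 = p₂) {p₃ : ℕ} (hp₃ : p₃.Prime) (hp₃1 : p₃ % 3 = 1) {a₃' b₃' : ℤ}
    (hab₃ : a₃' ^ 2 - a₃' * b₃' + b₃' ^ 2 = p₃) (hne₁₂ : p₁ ≠ p₂) (hne₁₃ : p₁ ≠ p₃) (hne₂₃ : p₂ ≠ p₃)
    {a₃ b₃ t m₃ s₃ : K3} (hb₃ : b₃ ≠ 0)
    (hd₃ : 4 * a₃ ^ 3 + 9 * b₃ ≠ 0) (ht : t ≠ 0) (hm₃ : t * m₃ = 3 * a₃) (hs₃ : t ^ 3 * s₃ = 4 * a₃ ^ 3 + 9 * b₃)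
    (hvs : ∀ w : HeightOneSpectrum (𝓞 K3), ((3 * N * p₁ * p₂ * p₃ : ℕ) : 𝓞 K3) ∉ w.asIdeal → w.valuation K3 (2 * s₃) = 1)
    (hvm : ∀ w : HeightOneSpectrum (𝓞 K3), ((3 * N * p₁ * p₂ * p₃ : ℕ) : 𝓞 K3) ∉ w.asIdeal → w.valuation K3 (2 * m₃) ≤ 1)
    (w₀ : HeightOneSpectrum (𝓞 K3)) (hw₀ : ((3 * N * p₁ * p₂ * p₃ : ℕ) : 𝓞 K3) ∉ w₀.asIdeal) (hw₀2 : w₀.valuation K3 2 = 1)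
    (hw₀s : w₀.valuation K3 s₃ = 1) (hw₀D : w₀.valuation K3 (27 * s₃ - 4 * m₃ ^ 3) < 1)
    (hw₀9 : ¬ 9 ∣ Ideal.absNorm w₀.asIdeal - 1)
    {c₁ c₂ c₃ : ℕ} {y₁ y₂ y₃ : 𝓞 K3} (hcert₁ : mkInt a₁ b₁ * mkInt (a₁ - b₁) (-b₁) ^ 2 - zetaInt ^ c₁ * y₁ ^ 3 ∈ w₀.asIdeal)
    (hcert₂ : mkInt a₂ b₂ * mkInt (a₂ - b₂) (-b₂) ^ 2 - zetaInt ^ c₂ * y₂ ^ 3 ∈ w₀.asIdeal)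
    (hcert₃ : mkInt a₃' b₃' * mkInt (a₃' - b₃') (-b₃') ^ 2 - zetaInt ^ c₃ * y₃ ^ 3 ∈ w₀.asIdeal)
    {e₁ e₂ e₃ : ℕ} (he₁ : 3 ∣ e₁ + c₁) (he₂ : 3 ∣ e₂ + c₂) (he₃ : 3 ∣ e₃ + c₃)
    (hgen₁ : cubeClass ((zeta : K3) ^ e₁ * ((⟨a₁, b₁⟩ : K3) * (⟨a₁ - b₁, -b₁⟩ : K3) ^ 2)) ∈ Subgroup.closure (Set.range
        fun P : (threeTorsionModel m₃ s₃).toAffine.Point => descentClass (threeTorsionModel m₃ s₃) m₃ s₃ P))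
    (hgen₂ : cubeClass ((zeta : K3) ^ e₂ * ((⟨a₂, b₂⟩ : K3) * (⟨a₂ - b₂, -b₂⟩ : K3) ^ 2)) ∈ Subgroup.closure (Set.range
        fun P : (threeTorsionModel m₃ s₃).toAffine.Point => descentClass (threeTorsionModel m₃ s₃) m₃ s₃ P))
    (hgen₃' : cubeClass ((zeta : K3) ^ e₃ * ((⟨a₃', b₃'⟩ : K3) * (⟨a₃' - b₃', -b₃'⟩ : K3) ^ 2)) ∈ Subgroup.closure (Set.range
        fun P : (threeTorsionModel m₃ s₃).toAffine.Point => descentClass (threeTorsionModel m₃ s₃) m₃ s₃ P))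
    {u : K3} (hu : u ≠ 0) (hsha : (kernelDatum hb₃ hd₃).torsorClass hu ∈ (cpCurve a₃ b₃).sha)
    (hnorm : ∃ r : ℚ, QuadraticAlgebra.norm u = r ^ 3) : (kernelDatum hb₃ hd₃).torsorClass hu = 0 := by
  set G := Subgroup.closure (Set.range
      fun P : (threeTorsionModel m₃ s₃).toAffine.Point => descentClass (threeTorsionModel m₃ s₃) m₃ s₃ P) with hG
  have hval : ∀ w : HeightOneSpectrum (𝓞 K3), ((3 * N * p₁ * p₂ * p₃ : ℕ) : 𝓞 K3) ∉ w.asIdeal →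
      (3 : ℤ) ∣ log (w.valuation K3 u) := by
    intro w hw
    obtain ⟨P, w', e, hw', hP⟩ :=
      exists_descent_pow_eq_adicCompletion_of_torsorClass_mem_sha hb₃ hd₃ ht hm₃ hs₃ hu hsha w
    have hval' : ∀ x : K3, Valued.v (algebraMap K3 (w.adicCompletion K3) x) = w.valuation K3 x :=
      fun x => valuedAdicCompletion_eq_valuation' w x
    have key := Carrier6137.three_dvd_log_of_descent_pow_eq' Valued.v (algebraMap K3 (w.adicCompletion K3))
      (by rw [hval']; exact hvs w hw) (by rw [hval']; exact hvm w hw) hu hw' hP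
    rwa [hval'] at key
  obtain ⟨i, k₁, k₂, k₃, -, hk₁, hk₂, hk₃, hi⟩ :=
    K3.exists_cubeClass_eq_of_norm_cube_split₃ hN0 hN hp₁ hp₁1 hab₁ hp₂ hp₂1 hab₂ hp₃ hp₃1 hab₃ hne₁₂ hne₁₃ hne₂₃ hu hval hnorm
  have hz : (zeta : K3) ≠ 0 := isPrimitiveRoot_zeta.ne_zero (by norm_num)
  have hϖ₁ := varpi_ne_zero₃' hp₁ hab₁
  have hϖ₁' := varpi_conj_ne_zero₃' hp₁ hab₁
  have hϖ₂ := varpi_ne_zero₃' hp₂ hab₂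
  have hϖ₂' := varpi_conj_ne_zero₃' hp₂ hab₂
  have hϖ₃ := varpi_ne_zero₃' hp₃ hab₃
  have hϖ₃' := varpi_conj_ne_zero₃' hp₃ hab₃
  have hg₃ : (⟨a₃', b₃'⟩ : K3) * (⟨a₃' - b₃', -b₃'⟩ : K3) ^ 2 ≠ 0 := mul_ne_zero hϖ₃ (pow_ne_zero _ hϖ₃')
  have hg₁ : (⟨a₁, b₁⟩ : K3) * (⟨a₁ - b₁, -b₁⟩ : K3) ^ 2 ≠ 0 := mul_ne_zero hϖ₁ (pow_ne_zero _ hϖ₁')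
  have hg₂ : (⟨a₂, b₂⟩ : K3) * (⟨a₂ - b₂, -b₂⟩ : K3) ^ 2 ≠ 0 := mul_ne_zero hϖ₂ (pow_ne_zero _ hϖ₂')
  have hw₀3 : (3 : 𝓞 K3) ∉ w₀.asIdeal := fun h => hw₀ (by
    rw [Nat.cast_mul, Nat.cast_mul, Nat.cast_mul, Nat.cast_mul, Nat.cast_ofNat, mul_assoc, mul_assoc, mul_assoc]
    exact w₀.asIdeal.mul_mem_right _ h)
  have hw₀p₁ : ((p₁ : ℕ) : 𝓞 K3) ∉ w₀.asIdeal := fun h => hw₀ (by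
    rw [Nat.cast_mul, Nat.cast_mul, Nat.cast_mul]
    exact w₀.asIdeal.mul_mem_right _ (w₀.asIdeal.mul_mem_right _ (w₀.asIdeal.mul_mem_left _ h)))
  have hw₀p₂ : ((p₂ : ℕ) : 𝓞 K3) ∉ w₀.asIdeal := fun h => hw₀ (by
    rw [Nat.cast_mul, Nat.cast_mul]; exact w₀.asIdeal.mul_mem_right _ (w₀.asIdeal.mul_mem_left _ h))
  have hw₀p₃ : ((p₃ : ℕ) : 𝓞 K3) ∉ w₀.asIdeal := fun h => hw₀ (by
    rw [Nat.cast_mul]; exact w₀.asIdeal.mul_mem_left _ h)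
  have hxInt₁ : ((mkInt a₁ b₁ : 𝓞 K3) : K3) = (⟨a₁, b₁⟩ : K3) := coe_mkInt a₁ b₁
  have hxInt₁' : ((mkInt (a₁ - b₁) (-b₁) : 𝓞 K3) : K3) = (⟨a₁ - b₁, -b₁⟩ : K3) := by
    rw [coe_mkInt]; push_cast; rfl
  have hxInt₂ : ((mkInt a₂ b₂ : 𝓞 K3) : K3) = (⟨a₂, b₂⟩ : K3) := coe_mkInt a₂ b₂
  have hxInt₂' : ((mkInt (a₂ - b₂) (-b₂) : 𝓞 K3) : K3) = (⟨a₂ - b₂, -b₂⟩ : K3) := by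
    rw [coe_mkInt]; push_cast; rfl
  have hxInt₃ : ((mkInt a₃' b₃' : 𝓞 K3) : K3) = (⟨a₃', b₃'⟩ : K3) := coe_mkInt a₃' b₃'
  have hxInt₃' : ((mkInt (a₃' - b₃') (-b₃') : 𝓞 K3) : K3) = (⟨a₃' - b₃', -b₃'⟩ : K3) := by
    rw [coe_mkInt]; push_cast; rfl
  have hmon : (zeta : K3) ^ i * ((⟨a₁, b₁⟩ : K3) * (⟨a₁ - b₁, -b₁⟩ : K3) ^ 2) ^ k₁ *
      ((⟨a₂, b₂⟩ : K3) * (⟨a₂ - b₂, -b₂⟩ : K3) ^ 2) ^ k₂ * ((⟨a₃', b₃'⟩ : K3) * (⟨a₃' - b₃', -b₃'⟩ : K3) ^ 2) ^ k₃ ≠ 0 :=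
    mul_ne_zero (mul_ne_zero (mul_ne_zero (pow_ne_zero i hz) (pow_ne_zero _ hg₁)) (pow_ne_zero _ hg₂)) (pow_ne_zero _ hg₃)
  obtain ⟨r, hr, hur⟩ := (cubeClass_eq_cubeClass_iff hu hmon).mp hi
  -- the node lemma at `w₀`: `u = β³(1 + ε)` in `K3_{w₀}`
  set L := w₀.adicCompletion K3 with hL
  set φ := algebraMap K3 L with hφ
  have hvalL : ∀ x : K3, Valued.v (φ x) = w₀.valuation K3 x := fun x => valuedAdicCompletion_eq_valuation' w₀ x
  obtain ⟨P, w', e, hw', hP⟩ :=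
    exists_descent_pow_eq_adicCompletion_of_torsorClass_mem_sha hb₃ hd₃ ht hm₃ hs₃ hu hsha w₀
  have h3' : w₀.valuation K3 (3 : K3) = 1 := by
    have h33 : ((3 : 𝓞 K3) : K3) = 3 := by simpa using coe_natCast_ringOfIntegers 3
    rw [← h33]; exact K3.valuation_coe_eq_one w₀ hw₀3
  have h2L : Valued.v (2 : L) = 1 := by rw [← map_ofNat φ 2, hvalL]; exact hw₀2
  have h3L : Valued.v (3 : L) = 1 := by rw [← map_ofNat φ 3, hvalL]; exact h3'
  have hsL : Valued.v (φ s₃) = 1 := by rw [hvalL]; exact hw₀s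
  have hDL : Valued.v (27 * φ s₃ - 4 * φ m₃ ^ 3) < 1 := by
    rw [show (27 : L) * φ s₃ - 4 * φ m₃ ^ 3 = φ (27 * s₃ - 4 * m₃ ^ 3) by
      rw [map_sub, map_mul, map_mul, map_pow, map_ofNat, map_ofNat], hvalL]
    exact hw₀D
  obtain ⟨c, ε, -, hε, huc⟩ := (Valued.v : Valuation L ℤᵐ⁰).eq_cube_mul_one_add_of_threeTorsionDescent_pow_eq
    (W := threeTorsionModel (φ m₃) (φ s₃)) rfl h2L h3L hsL hDL hw' hP
  have hr' : φ r ≠ 0 := (map_ne_zero φ).mpr hr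
  set g₁Int : 𝓞 K3 := mkInt a₁ b₁ * mkInt (a₁ - b₁) (-b₁) ^ 2 with hg₁def
  set g₂Int : 𝓞 K3 := mkInt a₂ b₂ * mkInt (a₂ - b₂) (-b₂) ^ 2 with hg₂def
  set g₃Int : 𝓞 K3 := mkInt a₃' b₃' * mkInt (a₃' - b₃') (-b₃') ^ 2 with hg₃def
  set xInt : 𝓞 K3 := zetaInt ^ i * g₁Int ^ k₁ * g₂Int ^ k₂ * g₃Int ^ k₃ with hxdef
  have hxK : (xInt : K3) = (zeta : K3) ^ i * ((⟨a₁, b₁⟩ : K3) * (⟨a₁ - b₁, -b₁⟩ : K3) ^ 2) ^ k₁ *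
      ((⟨a₂, b₂⟩ : K3) * (⟨a₂ - b₂, -b₂⟩ : K3) ^ 2) ^ k₂ * ((⟨a₃', b₃'⟩ : K3) * (⟨a₃' - b₃', -b₃'⟩ : K3) ^ 2) ^ k₃ := by
    rw [hxdef, hg₁def, hg₂def, hg₃def]; push_cast [coe_zetaInt, hxInt₁, hxInt₁', hxInt₂, hxInt₂', hxInt₃, hxInt₃']; ring
  have hxL : φ (xInt : K3) = (c / φ r) ^ 3 * (1 + ε) := by
    rw [hur, map_mul, map_pow] at huc
    rw [hxK, div_pow, div_mul_eq_mul_div, eq_div_iff (pow_ne_zero 3 hr')]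
    linear_combination huc
  obtain ⟨y, hy⟩ := exists_sub_pow_three_mem_of_eq_cube_mul w₀ hε hxL
  have hy₁ : y₁ ∉ w₀.asIdeal := cert_root_not_mem hab₁ hw₀p₁ hcert₁
  have hy₂ : y₂ ∉ w₀.asIdeal := cert_root_not_mem hab₂ hw₀p₂ hcert₂
  have hy₃ : y₃ ∉ w₀.asIdeal := cert_root_not_mem hab₃ hw₀p₃ hcert₃
  -- the relation `ζ^{i + c₁k₁ + c₂k₂ + c₃k₃} (y₁^{k₁} y₂^{k₂} y₃^{k₃})³ ≡ y³ (mod w₀)` read in `𝓞 K3 / w₀`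
  have hrel : zetaInt ^ (i + c₁ * k₁ + c₂ * k₂ + c₃ * k₃) * (y₁ ^ k₁ * y₂ ^ k₂ * y₃ ^ k₃) ^ 3 - y ^ 3 ∈ w₀.asIdeal := by
    rw [← Ideal.Quotient.eq]
    set π := Ideal.Quotient.mk w₀.asIdeal with hπ
    have h1 : π g₁Int = π zetaInt ^ c₁ * π y₁ ^ 3 := by
      have := (Ideal.Quotient.eq (I := w₀.asIdeal)).mpr hcert₁
      simpa [map_mul, map_pow] using this
    have h2 : π g₂Int = π zetaInt ^ c₂ * π y₂ ^ 3 := by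
      have := (Ideal.Quotient.eq (I := w₀.asIdeal)).mpr hcert₂
      simpa [map_mul, map_pow] using this
    have h3g : π g₃Int = π zetaInt ^ c₃ * π y₃ ^ 3 := by
      have := (Ideal.Quotient.eq (I := w₀.asIdeal)).mpr hcert₃
      simpa [map_mul, map_pow] using this
    have h3 : π xInt = π y ^ 3 := by
      have := (Ideal.Quotient.eq (I := w₀.asIdeal)).mpr hy
      simpa [map_pow] using this
    rw [hxdef, map_mul, map_mul, map_mul, map_pow, map_pow, map_pow, map_pow, h1, h2, h3g] at h3
    rw [map_pow, map_mul, map_pow, map_pow, map_mul, map_mul, map_pow, map_pow, map_pow, ← h3]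
    ring
  have ht12 : y₁ ^ k₁ * y₂ ^ k₂ * y₃ ^ k₃ ∉ w₀.asIdeal := by
    intro h
    rcases w₀.isPrime.mem_or_mem h with h | h
    · rcases w₀.isPrime.mem_or_mem h with h | h
      · exact hy₁ (w₀.isPrime.mem_of_pow_mem _ h)
      · exact hy₂ (w₀.isPrime.mem_of_pow_mem _ h)
    · exact hy₃ (w₀.isPrime.mem_of_pow_mem _ h)
  have h3 : 3 ∣ i + c₁ * k₁ + c₂ * k₂ + c₃ * k₃ := three_dvd_of_zetaInt_pow_mul_cube_sub_cube_mem hw₀3 hw₀9 ht12 hrel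
  -- so `[u] = ∏ [ζ^{eᵢ} ϖᵢϖ̄ᵢ²]^{kᵢ} ∈ G`
  have hmod : i % 3 = (e₁ * k₁ + e₂ * k₂ + e₃ * k₃) % 3 := by
    interval_cases k₁ <;> interval_cases k₂ <;> interval_cases k₃ <;> omega
  have hcl : cubeClass ((zeta : K3) ^ i * ((⟨a₁, b₁⟩ : K3) * (⟨a₁ - b₁, -b₁⟩ : K3) ^ 2) ^ k₁ *
      ((⟨a₂, b₂⟩ : K3) * (⟨a₂ - b₂, -b₂⟩ : K3) ^ 2) ^ k₂ * ((⟨a₃', b₃'⟩ : K3) * (⟨a₃' - b₃', -b₃'⟩ : K3) ^ 2) ^ k₃) =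
      cubeClass ((zeta : K3) ^ e₁ * ((⟨a₁, b₁⟩ : K3) * (⟨a₁ - b₁, -b₁⟩ : K3) ^ 2)) ^ k₁ *
        cubeClass ((zeta : K3) ^ e₂ * ((⟨a₂, b₂⟩ : K3) * (⟨a₂ - b₂, -b₂⟩ : K3) ^ 2)) ^ k₂ *
        cubeClass ((zeta : K3) ^ e₃ * ((⟨a₃', b₃'⟩ : K3) * (⟨a₃' - b₃', -b₃'⟩ : K3) ^ 2)) ^ k₃ := by
    rw [← cubeClass_pow_K3₃ (mul_ne_zero (pow_ne_zero _ hz) hg₁), ← cubeClass_pow_K3₃ (mul_ne_zero (pow_ne_zero _ hz) hg₂),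
      ← cubeClass_pow_K3₃ (mul_ne_zero (pow_ne_zero _ hz) hg₃),
      ← cubeClass_mul (pow_ne_zero _ (mul_ne_zero (pow_ne_zero _ hz) hg₁)) (pow_ne_zero _ (mul_ne_zero (pow_ne_zero _ hz) hg₂)),
      ← cubeClass_mul (mul_ne_zero (pow_ne_zero _ (mul_ne_zero (pow_ne_zero _ hz) hg₁))
        (pow_ne_zero _ (mul_ne_zero (pow_ne_zero _ hz) hg₂))) (pow_ne_zero _ (mul_ne_zero (pow_ne_zero _ hz) hg₃)),
      mul_assoc, mul_assoc, cubeClass_zeta_pow_mul_eq₃ hmod, show (zeta : K3) ^ (e₁ * k₁ + e₂ * k₂ + e₃ * k₃) *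
        (((⟨a₁, b₁⟩ : K3) * (⟨a₁ - b₁, -b₁⟩ : K3) ^ 2) ^ k₁ * (((⟨a₂, b₂⟩ : K3) * (⟨a₂ - b₂, -b₂⟩ : K3) ^ 2) ^ k₂ *
          ((⟨a₃', b₃'⟩ : K3) * (⟨a₃' - b₃', -b₃'⟩ : K3) ^ 2) ^ k₃)) =
        ((zeta : K3) ^ e₁ * ((⟨a₁, b₁⟩ : K3) * (⟨a₁ - b₁, -b₁⟩ : K3) ^ 2)) ^ k₁ *
          ((zeta : K3) ^ e₂ * ((⟨a₂, b₂⟩ : K3) * (⟨a₂ - b₂, -b₂⟩ : K3) ^ 2)) ^ k₂ *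
          ((zeta : K3) ^ e₃ * ((⟨a₃', b₃'⟩ : K3) * (⟨a₃' - b₃', -b₃'⟩ : K3) ^ 2)) ^ k₃ by ring]
  rw [(kernelDatum hb₃ hd₃).torsorClass_eq_zero_iff_cubeClass_mem_ker hu, hi, MonoidHom.mem_ker]
  refine torsorClassQuotHom_eq_one_of_mem_closure hb₃ hd₃ ht hm₃ hs₃ ?_
  rw [hcl]
  exact G.mul_mem (G.mul_mem (G.pow_mem hgen₁ k₁) (G.pow_mem hgen₂ k₂)) (G.pow_mem hgen₃' k₃)

/-! ## Booking a cross-prime cell at `3`: `α`-box over `ℚ`, three split primes in `b̂`, a killing place, THREE `K3`-points -/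

/-- Reassociation `3 * N * p₁ * p₂ * p₃ = 3 * (N * p₁ * p₂ * p₃)` under the cast (private). [cite: CohenPazuki2009, Theorem 2.1 (2)] -/
private theorem not_mem_assoc₃ {N p₁ p₂ p₃ : ℕ} {w : HeightOneSpectrum (𝓞 K3)}
    (hw : ((3 * N * p₁ * p₂ * p₃ : ℕ) : 𝓞 K3) ∉ w.asIdeal) : ((3 * (N * p₁ * p₂ * p₃) : ℕ) : 𝓞 K3) ∉ w.asIdeal := by
  rwa [← mul_assoc, ← mul_assoc, ← mul_assoc]

/-- **`Ш(E/ℚ)[3] = 0` for `E = threeTorsionModel m s`, three split primes in `b̂`, with the local condition at a killing place `w₀ ∣ s`**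
(`α`-box over `ℚ` from `S`; inert `N`, split `pᵢ = N(aᵢ + bᵢζ)` pairwise distinct; `w₀ ∌ 3Np₁p₂p₃`, `w₀(2) = 1`, `w₀(s) < 1`, `9 ∤ N(w₀) − 1`;
certificates `ϖᵢϖ̄ᵢ² ≡ ζ^{cᵢ} yᵢ³ (mod w₀)`; THREE descent classes `[ζ^{eᵢ} ϖᵢϖ̄ᵢ²]`, `3 ∣ eᵢ + cᵢ`, per sign of `θ₀`).
[cite: CohenPazuki2009, Theorem 2.1 and Proposition 2.2] [cite: SilvermanAEC2009, Thm. X.4.2 (a)] -/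
theorem forall_mem_sha_three_nsmul_eq_zero_of_gens_split₃NodeKill {m s : ℚ} [(threeTorsionModel m s).IsElliptic]
    (S : Finset ℕ) (hS : ∀ q ∈ S, q.Prime)
    (hout : ∀ q : ℕ, q.Prime → q ∉ S → padicValRat q (2 * s) = 0 ∧ 0 ≤ padicValRat q (2 * m))
    (hgen : ∀ q ∈ S, cubeClass (q : ℚ) ∈ Subgroup.closure (Set.range
      fun P : (threeTorsionModel m s).toAffine.Point => descentClass (threeTorsionModel m s) m s P))
    {N : ℕ} (hN0 : N ≠ 0) (hN : ∀ q ∈ N.primeFactors, q = 2 ∨ q % 3 = 2)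
    {p₁ : ℕ} (hp₁ : p₁.Prime) (hp₁1 : p₁ % 3 = 1) {a₁ b₁ : ℤ} (hab₁ : a₁ ^ 2 - a₁ * b₁ + b₁ ^ 2 = p₁)
    {p₂ : ℕ} (hp₂ : p₂.Prime) (hp₂1 : p₂ % 3 = 1) {a₂ b₂ : ℤ} (hab₂ : a₂ ^ 2 - a₂ * b₂ + b₂ ^ 2 = p₂)
    {p₃ : ℕ} (hp₃ : p₃.Prime) (hp₃1 : p₃ % 3 = 1) {a₃' b₃' : ℤ} (hab₃ : a₃' ^ 2 - a₃' * b₃' + b₃' ^ 2 = p₃)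
    (hne₁₂ : p₁ ≠ p₂) (hne₁₃ : p₁ ≠ p₃) (hne₂₃ : p₂ ≠ p₃)
    (hvb : ∀ w : HeightOneSpectrum (𝓞 K3), ((3 * N * p₁ * p₂ * p₃ : ℕ) : 𝓞 K3) ∉ w.asIdeal →
      w.valuation K3 (algebraMap ℚ K3 (2 * (3 * s - 4 * m ^ 3 / 9))) = 1)
    (hvm : ∀ w : HeightOneSpectrum (𝓞 K3), ((3 * N * p₁ * p₂ * p₃ : ℕ) : 𝓞 K3) ∉ w.asIdeal →
      w.valuation K3 (algebraMap ℚ K3 (2 * m)) ≤ 1)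
    (w₀ : HeightOneSpectrum (𝓞 K3)) (hw₀ : ((3 * N * p₁ * p₂ * p₃ : ℕ) : 𝓞 K3) ∉ w₀.asIdeal) (hw₀2 : w₀.valuation K3 2 = 1)
    (hw₀s : w₀.valuation K3 (algebraMap ℚ K3 s) < 1) (hw₀9 : ¬ 9 ∣ Ideal.absNorm w₀.asIdeal - 1)
    {c₁ c₂ c₃ : ℕ} {y₁ y₂ y₃ : 𝓞 K3} (hcert₁ : mkInt a₁ b₁ * mkInt (a₁ - b₁) (-b₁) ^ 2 - zetaInt ^ c₁ * y₁ ^ 3 ∈ w₀.asIdeal)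
    (hcert₂ : mkInt a₂ b₂ * mkInt (a₂ - b₂) (-b₂) ^ 2 - zetaInt ^ c₂ * y₂ ^ 3 ∈ w₀.asIdeal)
    (hcert₃ : mkInt a₃' b₃' * mkInt (a₃' - b₃') (-b₃') ^ 2 - zetaInt ^ c₃ * y₃ ^ 3 ∈ w₀.asIdeal)
    {e₁ e₂ e₃ : ℕ} (he₁ : 3 ∣ e₁ + c₁) (he₂ : 3 ∣ e₂ + c₂) (he₃ : 3 ∣ e₃ + c₃)
    (hgen₃ : ∀ θ₀ : K3, θ₀ ^ 2 = -3 →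
      cubeClass ((zeta : K3) ^ e₁ * ((⟨a₁, b₁⟩ : K3) * (⟨a₁ - b₁, -b₁⟩ : K3) ^ 2)) ∈ Subgroup.closure (Set.range
        fun P : (threeTorsionModel (algebraMap ℚ K3 m * θ₀) (algebraMap ℚ K3 (3 * s - 4 * m ^ 3 / 9) * θ₀)).toAffine.Point =>
          descentClass (threeTorsionModel (algebraMap ℚ K3 m * θ₀) (algebraMap ℚ K3 (3 * s - 4 * m ^ 3 / 9) * θ₀))
            (algebraMap ℚ K3 m * θ₀) (algebraMap ℚ K3 (3 * s - 4 * m ^ 3 / 9) * θ₀) P) ∧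
      cubeClass ((zeta : K3) ^ e₂ * ((⟨a₂, b₂⟩ : K3) * (⟨a₂ - b₂, -b₂⟩ : K3) ^ 2)) ∈ Subgroup.closure (Set.range
        fun P : (threeTorsionModel (algebraMap ℚ K3 m * θ₀) (algebraMap ℚ K3 (3 * s - 4 * m ^ 3 / 9) * θ₀)).toAffine.Point =>
          descentClass (threeTorsionModel (algebraMap ℚ K3 m * θ₀) (algebraMap ℚ K3 (3 * s - 4 * m ^ 3 / 9) * θ₀))
            (algebraMap ℚ K3 m * θ₀) (algebraMap ℚ K3 (3 * s - 4 * m ^ 3 / 9) * θ₀) P) ∧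
      cubeClass ((zeta : K3) ^ e₃ * ((⟨a₃', b₃'⟩ : K3) * (⟨a₃' - b₃', -b₃'⟩ : K3) ^ 2)) ∈ Subgroup.closure (Set.range
        fun P : (threeTorsionModel (algebraMap ℚ K3 m * θ₀) (algebraMap ℚ K3 (3 * s - 4 * m ^ 3 / 9) * θ₀)).toAffine.Point =>
          descentClass (threeTorsionModel (algebraMap ℚ K3 m * θ₀) (algebraMap ℚ K3 (3 * s - 4 * m ^ 3 / 9) * θ₀))
            (algebraMap ℚ K3 m * θ₀) (algebraMap ℚ K3 (3 * s - 4 * m ^ 3 / 9) * θ₀) P)) :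
    ∀ c ∈ (threeTorsionModel m s).sha, 3 • c = 0 → c = 0 :=
  forall_mem_sha_three_nsmul_eq_zero_of_gens_of_box S hS hout hgen
    (fun θ₀ => -(algebraMap ℚ K3 m / 3) * θ₀) (fun θ₀ => -(algebraMap ℚ K3 s / 3) * θ₀)
    (fun _ hθ => canonical₃_b_ne_zero (m := m) hθ) (fun _ hθ => canonical₃_d_ne_zero hθ)
    (fun _ hθ => canonical₃_baseChange_eq hθ) (fun _ hθ => canonical₃_hy hθ)
    (fun θ₀ hθ _ hu hsha hnorm => torsorClass_eq_zero_of_mem_sha_of_norm_cube_of_gens_split₃NodeKill hN0 hN hp₁ hp₁1 hab₁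
      hp₂ hp₂1 hab₂ hp₃ hp₃1 hab₃ hne₁₂ hne₁₃ hne₂₃ (canonical₃_b_ne_zero (m := m) hθ) (canonical₃_d_ne_zero hθ) (t := -1) (by norm_num) canonical₃_hm
      (canonical₃_hs hθ) (fun w hw => canonical₃_valuation_s hθ (not_mem_assoc₃ hw) (hvb w hw))
      (fun w hw => canonical₃_valuation_m hθ (not_mem_assoc₃ hw) (hvm w hw)) w₀ hw₀ hw₀2
      (canonical₃_valuation_s₃ hθ (not_mem_assoc₃ hw₀) hw₀2 (hvb w₀ hw₀))
      (canonical₃_valuation_D hθ (not_mem_assoc₃ hw₀) hw₀s) hw₀9 hcert₁ hcert₂ hcert₃ he₁ he₂ he₃ (hgen₃ θ₀ hθ).1 (hgen₃ θ₀ hθ).2.1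
      (hgen₃ θ₀ hθ).2.2 hu hsha hnorm)

/-- **`t_3(E_{m,s}) = corank_{ℤ₃} Ш(E/ℚ)[3^∞] = 0` BOOKED from the `α`-box over `ℚ`, three split primes with residue certificates at a
killing place, and THREE `K3`-points.** [cite: CohenPazuki2009, Proposition 2.2] [cite: SilvermanAEC2009, Thm. X.4.2 (a)] -/
theorem shaCorank_three_eq_zero_of_gens_split₃NodeKill {m s : ℚ} [(threeTorsionModel m s).IsElliptic]
    (S : Finset ℕ) (hS : ∀ q ∈ S, q.Prime)
    (hout : ∀ q : ℕ, q.Prime → q ∉ S → padicValRat q (2 * s) = 0 ∧ 0 ≤ padicValRat q (2 * m))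
    (hgen : ∀ q ∈ S, cubeClass (q : ℚ) ∈ Subgroup.closure (Set.range
      fun P : (threeTorsionModel m s).toAffine.Point => descentClass (threeTorsionModel m s) m s P))
    {N : ℕ} (hN0 : N ≠ 0) (hN : ∀ q ∈ N.primeFactors, q = 2 ∨ q % 3 = 2)
    {p₁ : ℕ} (hp₁ : p₁.Prime) (hp₁1 : p₁ % 3 = 1) {a₁ b₁ : ℤ} (hab₁ : a₁ ^ 2 - a₁ * b₁ + b₁ ^ 2 = p₁)
    {p₂ : ℕ} (hp₂ : p₂.Prime) (hp₂1 : p₂ % 3 = 1) {a₂ b₂ : ℤ} (hab₂ : a₂ ^ 2 - a₂ * b₂ + b₂ ^ 2 = p₂)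
    {p₃ : ℕ} (hp₃ : p₃.Prime) (hp₃1 : p₃ % 3 = 1) {a₃' b₃' : ℤ} (hab₃ : a₃' ^ 2 - a₃' * b₃' + b₃' ^ 2 = p₃)
    (hne₁₂ : p₁ ≠ p₂) (hne₁₃ : p₁ ≠ p₃) (hne₂₃ : p₂ ≠ p₃)
    (hvb : ∀ w : HeightOneSpectrum (𝓞 K3), ((3 * N * p₁ * p₂ * p₃ : ℕ) : 𝓞 K3) ∉ w.asIdeal →
      w.valuation K3 (algebraMap ℚ K3 (2 * (3 * s - 4 * m ^ 3 / 9))) = 1)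
    (hvm : ∀ w : HeightOneSpectrum (𝓞 K3), ((3 * N * p₁ * p₂ * p₃ : ℕ) : 𝓞 K3) ∉ w.asIdeal →
      w.valuation K3 (algebraMap ℚ K3 (2 * m)) ≤ 1)
    (w₀ : HeightOneSpectrum (𝓞 K3)) (hw₀ : ((3 * N * p₁ * p₂ * p₃ : ℕ) : 𝓞 K3) ∉ w₀.asIdeal) (hw₀2 : w₀.valuation K3 2 = 1)
    (hw₀s : w₀.valuation K3 (algebraMap ℚ K3 s) < 1) (hw₀9 : ¬ 9 ∣ Ideal.absNorm w₀.asIdeal - 1)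
    {c₁ c₂ c₃ : ℕ} {y₁ y₂ y₃ : 𝓞 K3} (hcert₁ : mkInt a₁ b₁ * mkInt (a₁ - b₁) (-b₁) ^ 2 - zetaInt ^ c₁ * y₁ ^ 3 ∈ w₀.asIdeal)
    (hcert₂ : mkInt a₂ b₂ * mkInt (a₂ - b₂) (-b₂) ^ 2 - zetaInt ^ c₂ * y₂ ^ 3 ∈ w₀.asIdeal)
    (hcert₃ : mkInt a₃' b₃' * mkInt (a₃' - b₃') (-b₃') ^ 2 - zetaInt ^ c₃ * y₃ ^ 3 ∈ w₀.asIdeal)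
    {e₁ e₂ e₃ : ℕ} (he₁ : 3 ∣ e₁ + c₁) (he₂ : 3 ∣ e₂ + c₂) (he₃ : 3 ∣ e₃ + c₃)
    (hgen₃ : ∀ θ₀ : K3, θ₀ ^ 2 = -3 →
      cubeClass ((zeta : K3) ^ e₁ * ((⟨a₁, b₁⟩ : K3) * (⟨a₁ - b₁, -b₁⟩ : K3) ^ 2)) ∈ Subgroup.closure (Set.range
        fun P : (threeTorsionModel (algebraMap ℚ K3 m * θ₀) (algebraMap ℚ K3 (3 * s - 4 * m ^ 3 / 9) * θ₀)).toAffine.Point =>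
          descentClass (threeTorsionModel (algebraMap ℚ K3 m * θ₀) (algebraMap ℚ K3 (3 * s - 4 * m ^ 3 / 9) * θ₀))
            (algebraMap ℚ K3 m * θ₀) (algebraMap ℚ K3 (3 * s - 4 * m ^ 3 / 9) * θ₀) P) ∧
      cubeClass ((zeta : K3) ^ e₂ * ((⟨a₂, b₂⟩ : K3) * (⟨a₂ - b₂, -b₂⟩ : K3) ^ 2)) ∈ Subgroup.closure (Set.range
        fun P : (threeTorsionModel (algebraMap ℚ K3 m * θ₀) (algebraMap ℚ K3 (3 * s - 4 * m ^ 3 / 9) * θ₀)).toAffine.Point =>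
          descentClass (threeTorsionModel (algebraMap ℚ K3 m * θ₀) (algebraMap ℚ K3 (3 * s - 4 * m ^ 3 / 9) * θ₀))
            (algebraMap ℚ K3 m * θ₀) (algebraMap ℚ K3 (3 * s - 4 * m ^ 3 / 9) * θ₀) P) ∧
      cubeClass ((zeta : K3) ^ e₃ * ((⟨a₃', b₃'⟩ : K3) * (⟨a₃' - b₃', -b₃'⟩ : K3) ^ 2)) ∈ Subgroup.closure (Set.range
        fun P : (threeTorsionModel (algebraMap ℚ K3 m * θ₀) (algebraMap ℚ K3 (3 * s - 4 * m ^ 3 / 9) * θ₀)).toAffine.Point =>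
          descentClass (threeTorsionModel (algebraMap ℚ K3 m * θ₀) (algebraMap ℚ K3 (3 * s - 4 * m ^ 3 / 9) * θ₀))
            (algebraMap ℚ K3 m * θ₀) (algebraMap ℚ K3 (3 * s - 4 * m ^ 3 / 9) * θ₀) P)) :
    (threeTorsionModel m s).shaCorank 3 = 0 :=
  haveI : Fact (Nat.Prime 3) := ⟨Nat.prime_three⟩
  shaCorank_eq_zero_of_forall _ 3 (forall_mem_sha_three_nsmul_eq_zero_of_gens_split₃NodeKill S hS hout hgen hN0 hN hp₁ hp₁1
    hab₁ hp₂ hp₂1 hab₂ hp₃ hp₃1 hab₃ hne₁₂ hne₁₃ hne₂₃ hvb hvm w₀ hw₀ hw₀2 hw₀s hw₀9 hcert₁ hcert₂ hcert₃ he₁ he₂ he₃ hgen₃)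

end CPMuDescent

end Literature.NumberTheory.EllipticCurves

end
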